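import Summits.PneNP.PneNP.Theorems.ChebyshevTracialDesignDipoleHitEigen
import Summits.PneNP.PneNP.Theorems.ChebyshevTracialDesignLevelMarginals
import HarnessLib

/-!
# Cell pnp-psdrank, route `ChebyshevTracialDesign`: the dipole hit bound with the level-class size discharged
# (route vocabulary `OddSet n`, `cc`, uniform column marginals)

Harmonic backbone of the `r = 1` rung of the crux `TracialDecayExp20` (stmt-PneNP-19878). The bound
`…DipoleHitEigen.kernelEigen_level_le_of_hit` (this seat) carries a hypothesis `hB : #{U : |U| = t, #cr(U,M) = c} ≤ B`
for all `M`; for odd `t` the level classes are Rothvoß's column classes of `Q_c(t)` [cite: Rothvoss2017, §2 (PDF p. 6)],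
all of the same size `colCount(c)` (`…LevelMarginals.colCount_eq`, uniform column marginal), so the hypothesis is
discharged with `B = colCount(c)` read off ANY reference matching `M₀`:
* `card_levelClass_eq` : the `t`-slice level class in the junta vocabulary (`cutCount`) is the column class in the route
  vocabulary (`OddSet n`, `cc`);
* `kernelEigen_level_le` : for odd `t` with `2κ ≤ t ≤ n/2`, injective disjoint dipoles `a, b : Fin (2κ) → Fin n`, every
  level `c`, every Gram class function `k` of the level-`c` incidence and every `M₀ : PMatch n`,
  `kernelEigen n t (2κ) k ≤ ((t−2κ)!)² · colCount_{M₀}(c)² · C(4κ,2κ) · pm(2κ) · pm(n−2κ) / ((Π_{i<t−2κ} ladder n (2κ) i) · 4^κ)`.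
Dividing by `λ₀(c) = rowCount(c)·colCount(c)` (lit's `kernelEigen_zero_eq_rowSum_mul_colSum`) gives eng g6's normalised
(B) `σ_{2κ}(c)² ≤ P_M[all dipoles hit]/E_U[φ²]`, uniformly in the level. [cite: Filmus2016, Lemma 2.3 (arXiv p. 5)]
WHAT THIS IS NOT: not (L2)/SNT, nothing on psd rank; constants not optimised. Supports crux stmt-PneNP-19878.
-/

set_option linter.dupNamespace false -- `Summit.PneNP.PneNP.…`: summit = sub-problem (D-0017)

namespace Summit.PneNP.PneNP.Theorems.ChebyshevTracialDesignDipoleHitLevel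

open Finset Literature.Barriers.PneNP Literature.Combinatorics.AssociationSchemes
open Literature.Combinatorics.AssociationSchemes.JohnsonHarmonics
open Literature.Combinatorics.AssociationSchemes.JohnsonSpectrum
open Summit.PneNP.PneNP.Theorems.ChebyshevTracialDesignDipoleHitEigen
open Summit.PneNP.PneNP.Theorems.ChebyshevTracialDesignLevelMarginals
open Summit.PneNP.PneNP.Theorems.ChebyshevTracialDesignJunta

variable {n : ℕ}

/-- **The `t`-slice level class is Rothvoß's column class.** For odd `t`, the `t`-subsets `U` of `Fin n` with
`#cr(U,M) = #{e ∈ M : cutCount U e = 1} = c` are in bijection with the odd cuts `U : OddSet n` with `|U| = t` and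
`cc U M = c`. [cite: Rothvoss2017, §2 (PDF p. 6)] -/
theorem card_levelClass_eq {t : ℕ} (ht : Odd t) (M : PMatch n) (c : ℕ) :
    ((univ.powersetCard t).filter (fun U : Finset (Fin n) => (M.1.filter fun e => cutCount U e = 1).card = c)).card =
      (univ.filter fun U : OddSet n => U.1.card = t ∧ cc U M = c).card := by
  classical
  symm
  refine card_bij (fun U _ => U.1) (fun U hU => ?_) (fun U _ U' _ h => Subtype.ext h) (fun U hU => ?_)
  · simp only [mem_filter, mem_univ, true_and] at hU
    rw [mem_filter, mem_powersetCard]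
    exact ⟨⟨subset_univ _, hU.1⟩, by rw [← cc_eq_card_filter]; exact hU.2⟩
  · rw [mem_filter, mem_powersetCard] at hU
    refine ⟨⟨U, by rw [hU.1.2]; exact ht⟩, ?_, rfl⟩
    simp only [mem_filter, mem_univ, true_and]
    exact ⟨hU.1.2, by rw [cc_eq_card_filter]; exact hU.2⟩

variable {κ : ℕ} {a b : Fin (2 * κ) → Fin n}

/-- **Uniform-in-the-level attenuation bound, route vocabulary.** For odd `t` with `2κ ≤ t ≤ n/2`, injective disjoint
dipoles, a level `c`, a Gram class function `k` of the level-`c` incidence on the `t`-sets and any reference matching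
`M₀` (whose column class size is `colCount(c)`):
`kernelEigen n t (2κ) k ≤ ((t−2κ)!)²·colCount(c)²·C(4κ,2κ)·pm(2κ)·pm(n−2κ) / ((Π_{i<t−2κ} ladder n (2κ) i)·2^{2κ})`.
[cite: Rothvoss2017, §2 (PDF p. 6)] -/
theorem kernelEigen_level_le {t : ℕ} (ht : Odd t) (hκt : 2 * κ ≤ t) (htn : 2 * t ≤ n)
    (ha : Function.Injective a) (hb : Function.Injective b) (hab : ∀ i j, a i ≠ b j) (c : ℕ) (k : ℕ → ℝ)
    (hA : ∀ U ∈ univ.powersetCard t, ∀ U' ∈ univ.powersetCard t,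
      ∑ M : PMatch n, (if (M.1.filter fun e => cutCount U e = 1).card = c then (1 : ℝ) else 0) *
        (if (M.1.filter fun e => cutCount U' e = 1).card = c then (1 : ℝ) else 0) = k (U ∩ U').card)
    (M₀ : PMatch n) :
    kernelEigen n t (2 * κ) k ≤
      (((t - 2 * κ).factorial : ℝ)) ^ 2 *
          ((univ.filter fun U : OddSet n => U.1.card = t ∧ cc U M₀ = c).card : ℝ) ^ 2 *
          (((4 * κ).choose (2 * κ) * pmCount (2 * κ) * pmCount (n - 2 * κ) : ℕ) : ℝ) /
        ((∏ i ∈ range (t - 2 * κ), ladder n (2 * κ) i) * (2 : ℝ) ^ (2 * κ)) := by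
  refine kernelEigen_level_le_of_hit hκt htn ha hb hab c k hA fun M => ?_
  rw [card_levelClass_eq ht M c, colCount_eq t c M M₀]

end Summit.PneNP.PneNP.Theorems.ChebyshevTracialDesignDipoleHitLevel
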